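import Literature.AlgebraicGeometry.Morphisms.GlueDataRelative
import Literature.AlgebraicGeometry.AbelianSchemes.AbelianSchemeOverZariskiGluing
import Literature.AlgebraicGeometry.AbelianSchemes.AbelianSchemeOverLevelBaseChange
import Literature.AlgebraicGeometry.AbelianSchemes.PolarizedAbelianSchemeWithLevel
import HarnessLib

/-!
# Gluing ABELIAN SCHEMES along a cocycle of the base (the junction FILE 1 + FILE 2 + FILE 3 of hand (h7))

Cell hodgecm-mathlib, F-DAG second hand (h7) «Zariski gluing of `S`-objects from a cocycle», FILE 5; consumer F-8
(8c) — the universal family over the glued moduli scheme `A⁰ = ⋃ V_R`: «restrictions of ONE family along open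
immersions + the transition isomorphisms of triples» (price sheet §3 F-8).  INPUT (`AbelianSchemeOver.CocycleDatum D`):
glue data `D` for the BASE in cocycle form (Mathlib `Scheme.GlueData`: slices `D.U i`, overlaps `D.V (i, j)`,
transitions `D.t i j`), an abelian scheme `Aᵢ → D.U i` on every slice, and ISOMORPHISMS OF ABELIAN SCHEMES between the
restricted families over the overlaps, `θ i j : Aᵢ|_{V(i,j)} ⥲ Aⱼ|_{V(j,i)}` covering `D.t i j` (a base change of group
schemes, ★ `IsBaseChangeVia`), with `θ i i = 𝟙` and the cocycle condition on triple overlaps (★ B-p04's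
`Morphisms.relativeT'`).  OUTPUT:

* `𝔊.total : Scheme.GlueData` (★ `relativeGlueData` of the total spaces), `𝔊.proj : 𝔊.total.glued ⟶ D.glued`
  (★ `relativeGlueData_existsUnique_map`) with cartesian charts `Aᵢ = proj⁻¹(Uᵢ)` (★ `relativeGlueData_isPullback_ι`);
* `𝔊.zariskiGluingDatum : ZariskiGluingDatum D.glued` — the charts `Aᵢ`, and over the double overlaps
  `Uᵢ ×_{A⁰} Uⱼ ≅ V(i,j)` (Mathlib `Scheme.GlueData.vPullbackConeIsLimit`) the restricted families `Aᵢ|_{V(i,j)}` with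
  `κ₁ =` the projection and `κ₂ = θ i j` followed by the projection (★ `baseChange_isBaseChangeVia`, ★
  `IsBaseChangeVia.trans`);
* **`𝔊.abelianScheme : AbelianSchemeOver D.glued`** on `Over.mk 𝔊.proj` (FILE 3b) and
  **`𝔊.isBaseChangeVia_abelianScheme i : (𝔊.A i).IsBaseChangeVia 𝔊.abelianScheme (D.ι i) (𝔊.total.ι i)`** — every
  slice family IS the restriction of the glued family, as a group scheme.

No named fact, no `sorry`, no instance.  HC_CM is proved only modulo the printed citations until rung 0 closes; this
file discharges none of them.

## References
* [StacksProject] The Stacks Project, Tag 01LH (Relative glueing), Tag 01JA (Glueing schemes).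
* [GortzWedhorn2020] U. Görtz, T. Wedhorn, *Algebraic Geometry I*, 2nd ed. (2020), Section (3.5) Prop. 3.10 (gluing
  of schemes), Section (4.15) (p. 116) (group schemes; base change).
* [MumfordFogartyKirwan1994] D. Mumford, J. Fogarty, F. Kirwan, *Geometric Invariant Theory*, 3rd ed. (1994), Ch. 7
  §2 Def. 7.2 (p. 129) (pull-back of families), Ch. 6 §1 Def. 6.1 (p. 115).
-/

noncomputable section

universe u

open CategoryTheory CategoryTheory.Limits AlgebraicGeometry MonoidalCategory CartesianMonoidalCategory
open Literature.AlgebraicGeometry.Morphisms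

namespace Literature.AlgebraicGeometry.AbelianSchemes

namespace AbelianSchemeOver

/-- Transport of the pull-back relation along an equality of base maps. [cite: MumfordFogartyKirwan1994, Ch. 7 §2 Definition 7.2 (p. 129)] -/
theorem IsBaseChangeVia.congr_base {S S' : Scheme.{u}} {A' : AbelianSchemeOver S'} {A : AbelianSchemeOver S}
    {g g' : S' ⟶ S} {G : A'.X.left ⟶ A.X.left} (e : g = g') (h : A'.IsBaseChangeVia A g G) :
    A'.IsBaseChangeVia A g' G :=
  e ▸ h

/-- **Cocycle datum of abelian schemes over glue data of the base** ([StacksProject, Tag 01LH] with group structures):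
an abelian scheme on every slice `D.U i`, isomorphisms of abelian schemes `θ i j` between the restrictions to the
overlaps covering the transitions `D.t i j` (`IsBaseChangeVia`: cartesian + unit + law), `θ i i = 𝟙`, and the
cocycle condition on triple overlaps (★ `Morphisms.relativeT'`). [cite: StacksProject, Tag 01LH]
[cite: MumfordFogartyKirwan1994, Ch. 7 §2 Definition 7.2 (p. 129)] -/
structure CocycleDatum (D : Scheme.GlueData.{u}) where
  /-- the abelian scheme over each slice -/
  A : ∀ i : D.J, AbelianSchemeOver (D.U i)
  /-- the transition isomorphisms of the restricted families, over `D.t i j` -/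
  θ : ∀ i j, pullback (A i).X.hom (D.f i j) ⟶ pullback (A j).X.hom (D.f j i)
  /-- `θ i j` is a base change of GROUP schemes along `D.t i j` -/
  hθ : ∀ i j, ((A i).baseChange (D.f i j)).IsBaseChangeVia ((A j).baseChange (D.f j i)) (D.t i j) (θ i j)
  /-- `θ i i = 𝟙` -/
  hθid : ∀ i, θ i i = 𝟙 _
  /-- the cocycle condition on triple overlaps -/
  hcoc : ∀ i j k, relativeT' D (fun i => (A i).X.left) (fun i => (A i).X.hom) θ (fun i j => (hθ i j).fst) i j k ≫
    relativeT' D (fun i => (A i).X.left) (fun i => (A i).X.hom) θ (fun i j => (hθ i j).fst) j k i ≫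
      relativeT' D (fun i => (A i).X.left) (fun i => (A i).X.hom) θ (fun i j => (hθ i j).fst) k i j = 𝟙 _

namespace CocycleDatum

variable {D : Scheme.GlueData.{u}} (𝔊 : CocycleDatum D)

/-- The glue datum of the TOTAL SPACES (★ `Morphisms.relativeGlueData`). [cite: StacksProject, Tag 01LH] -/
@[implicit_reducible]
def total : Scheme.GlueData.{u} :=
  relativeGlueData D (fun i => (𝔊.A i).X.left) (fun i => (𝔊.A i).X.hom) 𝔊.θ (fun i j => (𝔊.hθ i j).fst) 𝔊.hθid
    𝔊.hcoc

/-- The glued structure morphism `⋃ Aᵢ → ⋃ Uᵢ` (★ `relativeGlueData_existsUnique_map`). [cite: StacksProject, Tag 01LH] -/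
def proj : 𝔊.total.glued ⟶ D.glued :=
  (relativeGlueData_existsUnique_map D (fun i => (𝔊.A i).X.left) (fun i => (𝔊.A i).X.hom) 𝔊.θ
    (fun i j => (𝔊.hθ i j).fst) 𝔊.hθid 𝔊.hcoc).exists.choose

/-- On the chart `Aᵢ` the glued structure morphism is `Aᵢ → Uᵢ ↪ A⁰`. [cite: StacksProject, Tag 01LH] -/
@[reassoc]
theorem ι_proj (i : D.J) : 𝔊.total.ι i ≫ 𝔊.proj = (𝔊.A i).X.hom ≫ D.ι i :=
  (relativeGlueData_existsUnique_map D (fun i => (𝔊.A i).X.left) (fun i => (𝔊.A i).X.hom) 𝔊.θ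
    (fun i j => (𝔊.hθ i j).fst) 𝔊.hθid 𝔊.hcoc).exists.choose_spec i

/-- The charts are CARTESIAN: `Aᵢ = proj⁻¹(Uᵢ)` (★ `relativeGlueData_isPullback_ι`). [cite: StacksProject, Tag 01LH] -/
theorem isPullback_ι (i : D.J) : IsPullback (𝔊.total.ι i) (𝔊.A i).X.hom 𝔊.proj (D.ι i) :=
  relativeGlueData_isPullback_ι D (fun i => (𝔊.A i).X.left) (fun i => (𝔊.A i).X.hom) 𝔊.θ
    (fun i j => (𝔊.hθ i j).fst) 𝔊.hθid 𝔊.hcoc 𝔊.proj 𝔊.ι_proj i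

/-- The overlap `V(i,j)` of the base glue data IS the double overlap `Uᵢ ×_{A⁰} Uⱼ` of the charts (Mathlib
`Scheme.GlueData.vPullbackConeIsLimit`). [cite: GortzWedhorn2020, Section (3.5) Proposition 3.10] -/
theorem isPullback_V (D : Scheme.GlueData.{u}) (i j : D.J) :
    IsPullback (D.f i j) (D.t i j ≫ D.f j i) (D.ι i) (D.ι j) :=
  IsPullback.of_isLimit (D.vPullbackConeIsLimit i j)

/-- The restricted family `Aᵢ|_{V(i,j)}` transported to the double overlap `Uᵢ ×_{A⁰} Uⱼ`. [cite: MumfordFogartyKirwan1994, Ch. 7 §2 Definition 7.2 (p. 129)] -/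
def A₂ (i j : D.J) : AbelianSchemeOver (pullback (D.ι i) (D.ι j)) :=
  ((𝔊.A i).baseChange (D.f i j)).baseChange (isPullback_V D i j).isoPullback.inv

/-- `κ₁`: the projection `A₂ i j → Aᵢ` is a base change of group schemes along `Uᵢ ×_{A⁰} Uⱼ → Uᵢ` (★
`baseChange_isBaseChangeVia` twice, ★ `IsBaseChangeVia.trans`). [cite: MumfordFogartyKirwan1994, Ch. 7 §2 Definition 7.2 (p. 129)] -/
theorem isBaseChangeVia_κ₁ (i j : D.J) :
    (𝔊.A₂ i j).IsBaseChangeVia (𝔊.A i) (pullback.fst (D.ι i) (D.ι j))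
      (pullback.fst _ _ ≫ pullback.fst (𝔊.A i).X.hom (D.f i j)) :=
  IsBaseChangeVia.congr_base (isPullback_V D i j).isoPullback_inv_fst
    ((((𝔊.A i).baseChange (D.f i j)).baseChange_isBaseChangeVia (isPullback_V D i j).isoPullback.inv).trans
      ((𝔊.A i).baseChange_isBaseChangeVia (D.f i j)))

/-- `κ₂`: `θ i j` followed by the projection `A₂ i j → Aⱼ` is a base change of group schemes along
`Uᵢ ×_{A⁰} Uⱼ → Uⱼ` (uses `hθ`). [cite: MumfordFogartyKirwan1994, Ch. 7 §2 Definition 7.2 (p. 129)] -/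
theorem isBaseChangeVia_κ₂ (i j : D.J) :
    (𝔊.A₂ i j).IsBaseChangeVia (𝔊.A j) (pullback.snd (D.ι i) (D.ι j))
      ((pullback.fst _ _ ≫ 𝔊.θ i j) ≫ pullback.fst (𝔊.A j).X.hom (D.f j i)) := by
  have e : ((isPullback_V D i j).isoPullback.inv ≫ D.t i j) ≫ D.f j i = pullback.snd (D.ι i) (D.ι j) := by
    rw [Category.assoc]
    exact (isPullback_V D i j).isoPullback_inv_snd
  exact IsBaseChangeVia.congr_base e
    (((((𝔊.A i).baseChange (D.f i j)).baseChange_isBaseChangeVia (isPullback_V D i j).isoPullback.inv).trans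
      (𝔊.hθ i j)).trans ((𝔊.A j).baseChange_isBaseChangeVia (D.f j i)))

/-- `κ₁ ≫ ιᵢ = κ₂ ≫ ιⱼ` in the glued total space: the glue condition of `𝔊.total`.
[cite: StacksProject, Tag 01JA] -/
theorem κ₁_comp_ι (i j : D.J) :
    (pullback.fst ((𝔊.A i).baseChange (D.f i j)).X.hom (isPullback_V D i j).isoPullback.inv ≫
        pullback.fst (𝔊.A i).X.hom (D.f i j)) ≫ 𝔊.total.ι i =
      ((pullback.fst ((𝔊.A i).baseChange (D.f i j)).X.hom (isPullback_V D i j).isoPullback.inv ≫ 𝔊.θ i j) ≫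
        pullback.fst (𝔊.A j).X.hom (D.f j i)) ≫ 𝔊.total.ι j := by
  rw [Category.assoc, Category.assoc, Category.assoc]
  exact congrArg (pullback.fst _ _ ≫ ·) (𝔊.total.glue_condition i j).symm

/-- **The Zariski gluing datum over the glued base `A⁰ = D.glued`** assembled from the cocycle datum: charts `Aᵢ`
(cartesian by `isPullback_ι`), overlap families `A₂ i j`, `κ₁` = the projection to `Aᵢ`, `κ₂` = `θ i j` followed by
the projection to `Aⱼ`. [cite: StacksProject, Tag 01LH] [cite: MumfordFogartyKirwan1994, Ch. 7 §2 Definition 7.2 (p. 129)] -/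
def zariskiGluingDatum : ZariskiGluingDatum D.glued where
  Z := Over.mk 𝔊.proj
  𝒰 := D.openCover
  A := 𝔊.A
  χ i := 𝔊.total.ι i
  hχ i := 𝔊.isPullback_ι i
  A₂ := 𝔊.A₂
  κ₁ i j := pullback.fst _ _ ≫ pullback.fst (𝔊.A i).X.hom (D.f i j)
  κ₂ i j := (pullback.fst _ _ ≫ 𝔊.θ i j) ≫ pullback.fst (𝔊.A j).X.hom (D.f j i)
  hκ₁ := 𝔊.isBaseChangeVia_κ₁
  hκ₂ := 𝔊.isBaseChangeVia_κ₂
  hκ := 𝔊.κ₁_comp_ι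

/-- **The glued abelian scheme over the glued base** `A⁰ = ⋃ Uᵢ`, on the glued total space `⋃ Aᵢ → A⁰` (FILE 3b
`ZariskiGluingDatum.abelianScheme`). [cite: MumfordFogartyKirwan1994, Ch. 6 §1 Definition 6.1 (p. 115)]
[cite: StacksProject, Tag 01LH] -/
def abelianScheme : AbelianSchemeOver D.glued :=
  𝔊.zariskiGluingDatum.abelianScheme

/-- The underlying `A⁰`-scheme of the glued abelian scheme is the glued total space with `proj`.
[cite: StacksProject, Tag 01LH] -/
@[simp]
theorem abelianScheme_X : 𝔊.abelianScheme.X = Over.mk 𝔊.proj := rfl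

/-- **Every slice family `Aᵢ → Uᵢ` is the restriction of the glued abelian scheme to `Uᵢ ↪ A⁰`, AS A GROUP SCHEME**
(via the chart `Aᵢ ↪ ⋃ Aᵢ`). [cite: MumfordFogartyKirwan1994, Ch. 7 §2 Definition 7.2 (p. 129)] [cite: StacksProject, Tag 01LH] -/
theorem isBaseChangeVia_abelianScheme (i : D.J) :
    (𝔊.A i).IsBaseChangeVia 𝔊.abelianScheme (D.ι i) (𝔊.total.ι i) :=
  𝔊.zariskiGluingDatum.isBaseChangeVia_abelianScheme i

/-- Relative dimension of the glued abelian scheme from the slices. [cite: GortzWedhorn2020, Section (4.9) Definition 4.29] -/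
theorem isOfRelDim_abelianScheme {g : ℕ} (h : ∀ i, (𝔊.A i).IsOfRelDim g) : 𝔊.abelianScheme.IsOfRelDim g :=
  𝔊.zariskiGluingDatum.isOfRelDim_abelianScheme h

end CocycleDatum

end AbelianSchemeOver

end Literature.AlgebraicGeometry.AbelianSchemes

end
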